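import Summits.ResolutionOfSingularities.ResolutionOfSingularities.Theorems.MarkedTransferCampaignW24ReducedRunDeath
import HarnessLib

/-!
# A VERIFIED `𝔽_p` DIGIT-LIST EVALUATOR FOR THE UNIVERSAL REDUCED CASE-(I) RUN — explicit states of `univRun` over any prime `p`
# become kernel-decidable list computations
# (HIRONAKA-L, kernel tool in the OURS reduced model of slot W2.4 / RD-2′ (`CampaignW24.ReducedRun`); res-type-059 g14; the odd-`p`
# counterpart of res-D-pv-035's `𝔽₂`-bitmask evaluator `MarkedTransferCampaignW24ReducedRunBits.lean`)

**HONEST FRAMING.** OURS bookkeeping: plumbing that turns explicit polynomial identities over `𝔽_p` (inside any field `K` of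
characteristic `p`) into kernel-decidable statements about lists of natural numbers, so that finitely many states of a universal
reduced run (`univStep` / `univRun`, `MarkedTransferCampaignW24ReducedRunUniversal.lean`) can be certified — e.g. the period of an
immortal run (`MarkedTransferCampaignW24ReducedRunRenormCycle.lean`). Nothing below is a statement of [Hironaka2017] (lit key
`paper:url-3343fd9e678b`), nothing asserts that any statement of it holds, nothing is a claim about resolution of singularities in
characteristic `p`; the manuscript stays «under review» (D-0012/D-0089). AI work, weaker than expert review.

## What is defined / proved (`K` a field of characteristic `p`)
* `ofList A = Σ_m ↑(A_m)·t^m` (`coeff_ofList`), digit lists `A : List ℕ` read through `lget` (0 beyond the end).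
* list operations `lzeroAt`, `lbuildFrom`, `psum`, `lconv`, `lmul p` (product mod `p`), `lbinom p fuel` (Lucas), `lhasse p fuel k`
  (divided derivative), `lnegScale p c` (`x ↦ −c·x`), `lstepWith p fuel k ainv` (the universal step with supplied bottom index and
  inverse), `lrunWith` (iteration), with the correctness theorems `ofList_lzeroAt`, **`ofList_lmul`**, `lbinom_modEq` (Lucas with fuel),
  **`D_ofList`**, `ofList_lnegScale`, `order_ofList`, **`univStep_ofList`** and **`univRun_ofList`**: under the decidable side conditions
  `stepOK` / `runOK` (bottom index, non-vanishing, inverse, Lucas fuel), `univRun (ofList A) n = ofList (lrunWith p fuel A steps)`;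
  `coeff_C_mul_rescale_ofList` / `coeff_ofList_eq_of_check`: a contracted-class identity (the `hcyc` of the renormalisation /
  immortality theorems) from a finite digit check.
Hypotheses: each theorem's own binders. Standard axioms; every remaining check on explicit data is `decide`.
-/

noncomputable section

set_option linter.dupNamespace false -- mandated namespace of this single-conjunct summit

namespace Summit.ResolutionOfSingularities.ResolutionOfSingularities.Theorems

namespace CampaignW24

namespace ReducedRun

open PowerSeries

universe u

/-! ## Digit lists and their arithmetic (computable) -/

section Lists

/-- [OURS tool] Entry `m` of a digit list, `0` beyond its end. [folklore] -/
def lget : List ℕ → ℕ → ℕ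
  | [], _ => 0
  | x :: _, 0 => x
  | _ :: xs, m + 1 => lget xs m

/-- [OURS tool] Zero out entry `k`. [folklore] -/
def lzeroAt : List ℕ → ℕ → List ℕ
  | [], _ => []
  | _ :: xs, 0 => 0 :: xs
  | x :: xs, m + 1 => x :: lzeroAt xs m

/-- [OURS tool] The list `[f s, f (s+1), …, f (s+n−1)]`. [folklore] -/
def lbuildFrom (f : ℕ → ℕ) : ℕ → ℕ → List ℕ
  | _, 0 => []
  | s, n + 1 => f s :: lbuildFrom f (s + 1) n

/-- [OURS tool] Partial sums `f 0 + ⋯ + f n`. [folklore] -/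
def psum (f : ℕ → ℕ) : ℕ → ℕ
  | 0 => f 0
  | n + 1 => psum f n + f (n + 1)

/-- [OURS tool] Convolution coefficient `Σ_{i ≤ n} A_i · B_{n−i}`. [folklore] -/
def lconv (A B : List ℕ) (n : ℕ) : ℕ := psum (fun i => lget A i * lget B (n - i)) n

/-- [OURS tool] Product of digit lists modulo `p`. [folklore] -/
def lmul (p : ℕ) (A B : List ℕ) : List ℕ := lbuildFrom (fun n => lconv A B n % p) 0 (A.length + B.length)

/-- [OURS tool] `C(m, k) mod p` by Lucas' digits, with fuel (correct when `k < p^fuel`). [folklore] -/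
def lbinom (p : ℕ) : ℕ → ℕ → ℕ → ℕ
  | 0, _, _ => 1
  | fuel + 1, m, k => (m % p).choose (k % p) % p * lbinom p fuel (m / p) (k / p) % p

/-- [OURS tool] The divided derivative `D^{(k)}` on digit lists modulo `p`. [folklore] -/
def lhasse (p fuel k : ℕ) (A : List ℕ) : List ℕ :=
  lbuildFrom (fun n => lbinom p fuel (n + k) k * lget A (n + k) % p) 0 (A.length - k)

/-- [OURS tool] Entrywise `x ↦ −c·x (mod p)`. [folklore] -/
def lnegScale (p c : ℕ) : List ℕ → List ℕ
  | [] => []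
  | x :: xs => (p - c * x % p) % p :: lnegScale p c xs

/-- [OURS tool] The universal Case-(I) step on digit lists, with the bottom index `k` and an inverse `ainv` of the bottom digit
supplied: `A ↦ −ainv · A · D^{(k)}(A with entry k zeroed)`. [folklore] -/
def lstepWith (p fuel k ainv : ℕ) (A : List ℕ) : List ℕ :=
  lnegScale p ainv (lmul p A (lhasse p fuel k (lzeroAt A k)))

/-- [OURS tool] Iterate `lstepWith` along a list of `(k, ainv)` pairs. [folklore] -/
def lrunWith (p fuel : ℕ) : List ℕ → List (ℕ × ℕ) → List ℕ
  | A, [] => A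
  | A, s :: rest => lrunWith p fuel (lstepWith p fuel s.1 s.2 A) rest

/-- [OURS tool] Side conditions of one list step (Boolean): Lucas fuel, `k` is the bottom index, `ainv` inverts the bottom
digit. [folklore] -/
def stepOK (p fuel k ainv : ℕ) (A : List ℕ) : Bool :=
  decide (k < p ^ fuel ∧ (∀ m < k, lget A m % p = 0) ∧ lget A k % p ≠ 0 ∧ lget A k * ainv % p = 1)

/-- [OURS tool] Side conditions along an iterated list run (Boolean). [folklore] -/
def runOK (p fuel : ℕ) : List ℕ → List (ℕ × ℕ) → Bool
  | _, [] => true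
  | A, s :: rest => stepOK p fuel s.1 s.2 A && runOK p fuel (lstepWith p fuel s.1 s.2 A) rest

/-! ### List lemmas -/

/-- Entries beyond the end vanish. [folklore] -/
theorem lget_eq_zero_of_le : ∀ (A : List ℕ) (m : ℕ), A.length ≤ m → lget A m = 0
  | [], _, _ => rfl
  | _ :: _, 0, h => absurd h (by simp)
  | _ :: xs, m + 1, h => lget_eq_zero_of_le xs m (by simpa using h)

/-- Entries of `lzeroAt`. [folklore] -/
theorem lget_lzeroAt : ∀ (A : List ℕ) (k m : ℕ), lget (lzeroAt A k) m = if m = k then 0 else lget A m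
  | [], k, m => by simp [lzeroAt, lget]
  | x :: xs, 0, 0 => rfl
  | x :: xs, 0, m + 1 => rfl
  | x :: xs, k + 1, 0 => rfl
  | x :: xs, k + 1, m + 1 => by
    rw [lzeroAt, lget, lget, lget_lzeroAt xs k m]
    simp

/-- `lzeroAt` keeps the length. [folklore] -/
theorem length_lzeroAt : ∀ (A : List ℕ) (k : ℕ), (lzeroAt A k).length = A.length
  | [], _ => rfl
  | _ :: _, 0 => rfl
  | _ :: xs, k + 1 => by rw [lzeroAt, List.length_cons, List.length_cons, length_lzeroAt xs k]

/-- Entries of `lbuildFrom`. [folklore] -/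
theorem lget_lbuildFrom (f : ℕ → ℕ) : ∀ (s n m : ℕ), lget (lbuildFrom f s n) m = if m < n then f (s + m) else 0
  | s, 0, m => by simp [lbuildFrom, lget]
  | s, n + 1, 0 => by simp [lbuildFrom, lget]
  | s, n + 1, m + 1 => by
    rw [lbuildFrom, lget, lget_lbuildFrom f (s + 1) n m]
    simp [Nat.add_assoc, Nat.add_comm 1 m]

/-- Length of `lbuildFrom`. [folklore] -/
theorem length_lbuildFrom (f : ℕ → ℕ) : ∀ (s n : ℕ), (lbuildFrom f s n).length = n
  | _, 0 => rfl
  | s, n + 1 => by rw [lbuildFrom, List.length_cons, length_lbuildFrom f (s + 1) n]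

/-- `psum` is the `Finset.range` sum. [folklore] -/
theorem psum_eq_sum (f : ℕ → ℕ) : ∀ n : ℕ, psum f n = ∑ i ∈ Finset.range (n + 1), f i
  | 0 => by simp [psum]
  | n + 1 => by rw [psum, psum_eq_sum f n, Finset.sum_range_succ f (n + 1)]

/-- Entries of `lnegScale`. [folklore] -/
theorem lget_lnegScale (p c : ℕ) : ∀ (A : List ℕ) (m : ℕ), lget (lnegScale p c A) m = (p - c * lget A m % p) % p
  | [], m => by simp [lnegScale, lget]
  | x :: xs, 0 => rfl
  | x :: xs, m + 1 => by rw [lnegScale, lget, lget, lget_lnegScale p c xs m]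

/-- Length of `lnegScale`. [folklore] -/
theorem length_lnegScale (p c : ℕ) : ∀ A : List ℕ, (lnegScale p c A).length = A.length
  | [] => rfl
  | _ :: xs => by rw [lnegScale, List.length_cons, List.length_cons, length_lnegScale p c xs]

/-- **Lucas with fuel**: `C(m, k) ≡ lbinom p fuel m k (mod p)` whenever `k < p^fuel`. [folklore] -/
theorem lbinom_modEq (p : ℕ) [hp : Fact p.Prime] : ∀ (fuel m k : ℕ), k < p ^ fuel → m.choose k ≡ lbinom p fuel m k [MOD p]
  | 0, m, k, hk => by
    have : k = 0 := by simpa using hk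
    subst this
    simp [lbinom, Nat.ModEq.refl]
  | fuel + 1, m, k, hk => by
    have hp0 : 0 < p := hp.out.pos
    have hk' : k / p < p ^ fuel := by
      rw [Nat.div_lt_iff_lt_mul hp0]
      simpa [pow_succ] using hk
    have h1 := Choose.choose_modEq_choose_mod_mul_choose_div_nat (n := m) (k := k) (p := p)
    have h2 := lbinom_modEq p fuel (m / p) (k / p) hk'
    rw [lbinom]
    calc m.choose k ≡ (m % p).choose (k % p) * (m / p).choose (k / p) [MOD p] := h1
      _ ≡ (m % p).choose (k % p) % p * lbinom p fuel (m / p) (k / p) [MOD p] :=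
          (Nat.mod_modEq _ _).symm.mul h2
      _ ≡ (m % p).choose (k % p) % p * lbinom p fuel (m / p) (k / p) % p [MOD p] := (Nat.mod_modEq _ _).symm

end Lists

/-! ## The series of a digit list and the correctness of the list operations -/

section Eval

variable {K : Type u} [Field K]

/-- [OURS tool] The power series `Σ_m ↑(A_m)·t^m` of a digit list. [folklore] -/
def ofList (A : List ℕ) : K⟦X⟧ := mk fun m => (lget A m : K)

/-- Coefficients of `ofList`. [folklore] -/
theorem coeff_ofList (A : List ℕ) (m : ℕ) : coeff m (ofList A : K⟦X⟧) = (lget A m : K) := coeff_mk _ _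

/-- `ofList (lzeroAt A k) = ofList A − ↑(A_k)·t^k`. [folklore] -/
theorem ofList_lzeroAt (A : List ℕ) (k : ℕ) :
    (ofList (lzeroAt A k) : K⟦X⟧) = ofList A - C ((lget A k : ℕ) : K) * X ^ k := by
  ext m
  rw [coeff_ofList, map_sub, coeff_ofList, coeff_C_mul, coeff_X_pow, lget_lzeroAt]
  split_ifs with h
  · rw [h, mul_one, sub_self, Nat.cast_zero]
  · rw [mul_zero, sub_zero]

variable (p : ℕ) [hp : Fact p.Prime] [CharP K p]

omit hp in
/-- Casting a residue: `↑(x % p) = ↑x` in characteristic `p`. [folklore] -/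
theorem natCast_mod (x : ℕ) : ((x % p : ℕ) : K) = (x : K) :=
  CharP.natCast_eq_natCast' K p (Nat.mod_modEq x p)

omit hp in
/-- **Products**: `ofList (lmul p A B) = ofList A · ofList B`. [folklore] -/
theorem ofList_lmul (A B : List ℕ) : (ofList (lmul p A B) : K⟦X⟧) = ofList A * ofList B := by
  ext m
  have hsum : coeff m ((ofList A : K⟦X⟧) * ofList B) = ((lconv A B m : ℕ) : K) := by
    rw [coeff_mul, Finset.Nat.sum_antidiagonal_eq_sum_range_succ_mk, lconv, psum_eq_sum, Nat.cast_sum]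
    refine Finset.sum_congr rfl fun i _ => ?_
    rw [coeff_ofList, coeff_ofList, Nat.cast_mul]
  rw [hsum, coeff_ofList, lmul, lget_lbuildFrom, zero_add]
  split_ifs with h
  · rw [natCast_mod]
  · -- beyond `|A| + |B|` every product `A_i · B_{m−i}` vanishes
    have h0 : lconv A B m = 0 := by
      rw [lconv, psum_eq_sum]
      refine Finset.sum_eq_zero fun i hi => ?_
      rw [Finset.mem_range] at hi
      by_cases hA : A.length ≤ i
      · rw [lget_eq_zero_of_le A i hA, zero_mul]
      · rw [lget_eq_zero_of_le B (m - i) (by omega), mul_zero]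
    rw [h0]

/-- **Divided derivatives**: `D^{(k)} (ofList A) = ofList (lhasse p fuel k A)` when `k < p^fuel`. [folklore] -/
theorem D_ofList {fuel k : ℕ} (hk : k < p ^ fuel) (A : List ℕ) :
    D k (ofList A : K⟦X⟧) = ofList (lhasse p fuel k A) := by
  ext n
  rw [coeff_D, coeff_ofList, coeff_ofList, lhasse, lget_lbuildFrom, zero_add]
  split_ifs with h
  · rw [natCast_mod, Nat.cast_mul, CharP.natCast_eq_natCast' K p (lbinom_modEq p fuel (n + k) k hk)]
  · rw [lget_eq_zero_of_le A (n + k) (by omega), Nat.cast_zero, mul_zero]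

/-- **Negated scaling**: `ofList (lnegScale p c A) = −(C ↑c · ofList A)`. [folklore] -/
theorem ofList_lnegScale (c : ℕ) (A : List ℕ) : (ofList (lnegScale p c A) : K⟦X⟧) = -(C (c : K) * ofList A) := by
  ext m
  rw [coeff_ofList, lget_lnegScale, map_neg, coeff_C_mul, coeff_ofList, natCast_mod]
  have hle : c * lget A m % p ≤ p := (Nat.mod_lt _ hp.out.pos).le
  rw [Nat.cast_sub hle, CharP.cast_eq_zero, zero_sub, natCast_mod, Nat.cast_mul]

omit hp in
/-- **Bottom digit**: if the entries below `k` are `≡ 0` and entry `k` is `≢ 0 (mod p)`, then `ord (ofList A) = k`. [folklore] -/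
theorem order_ofList {k : ℕ} {A : List ℕ} (hk : ∀ m < k, lget A m % p = 0) (hk' : lget A k % p ≠ 0) :
    order (ofList A : K⟦X⟧) = k := by
  rw [order_eq_nat]
  refine ⟨?_, fun m hm => ?_⟩
  · rw [coeff_ofList, Ne, CharP.cast_eq_zero_iff K p]
    exact fun h => hk' (Nat.mod_eq_zero_of_dvd h)
  · rw [coeff_ofList, CharP.cast_eq_zero_iff K p]
    exact Nat.dvd_of_mod_eq_zero (hk m hm)

/-- **THE UNIVERSAL STEP ON DIGIT LISTS.** Under `stepOK` (Lucas fuel `k < p^fuel`, `k` the bottom index, `ainv` an inverse of the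
bottom digit), `univStep (ofList A) = ofList (lstepWith p fuel k ainv A)`. [folklore] -/
theorem univStep_ofList {fuel k ainv : ℕ} {A : List ℕ} (h : stepOK p fuel k ainv A = true) :
    univStep (ofList A : K⟦X⟧) = ofList (lstepWith p fuel k ainv A) := by
  obtain ⟨hfuel, hk, hk', hinv⟩ := of_decide_eq_true h
  have hord : order (ofList A : K⟦X⟧) = k := order_ofList p hk hk'
  have hinvK : ((lget A k : ℕ) : K)⁻¹ = (ainv : K) := by
    refine inv_eq_of_mul_eq_one_right ?_
    rw [← Nat.cast_mul, ← natCast_mod p, hinv, Nat.cast_one]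
  rw [univStep, hord, ENat.toNat_coe, univStepI, coeff_ofList, hinvK, lstepWith, ofList_lnegScale, ofList_lmul,
    ← D_ofList p hfuel, ofList_lzeroAt]

/-- **THE UNIVERSAL RUN ON DIGIT LISTS.** Under `runOK` along the supplied `(k, ainv)` pairs,
`univRun (ofList A) (number of steps) = ofList (lrunWith p fuel A steps)`. [folklore] -/
theorem univRun_ofList {fuel : ℕ} : ∀ (steps : List (ℕ × ℕ)) (A : List ℕ), runOK p fuel A steps = true →
    univRun (ofList A : K⟦X⟧) steps.length = ofList (lrunWith p fuel A steps)
  | [], _, _ => rfl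
  | s :: rest, A, h => by
    rw [runOK, Bool.and_eq_true] at h
    rw [List.length_cons, univRun_succ_eq_univRun_univStep, univStep_ofList p h.1, lrunWith]
    exact univRun_ofList rest _ h.2

omit hp in
/-- **Finite check of a contracted-class identity** (the hypothesis `hcyc` of the immortality criterion
`univRun_ne_zero_of_cycle` / of the renormalisation theorems, for explicit digit lists): if `|A| ≤ q·R + B`, `|S| ≤ R` and
`c·l^r·S_r ≡ A_{q·r+B} (mod p)` for `r < R`, then `coeff r (C ↑c · (ofList S)(↑l·t)) = coeff (q·r + B) (ofList A)` for EVERY `r`.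
[folklore] -/
theorem coeff_C_mul_rescale_ofList {S A : List ℕ} {c l q B R : ℕ} (hA : A.length ≤ q * R + B) (hS : S.length ≤ R)
    (h : ∀ r < R, c * l ^ r * lget S r % p = lget A (q * r + B) % p) (r : ℕ) :
    coeff r (C (c : K) * rescale (l : K) (ofList S)) = coeff (q * r + B) (ofList A : K⟦X⟧) := by
  rw [coeff_C_mul, coeff_rescale, coeff_ofList, coeff_ofList,
    show (c : K) * ((l : K) ^ r * (lget S r : K)) = ((c * l ^ r * lget S r : ℕ) : K) by push_cast; ring]
  by_cases hr : r < R
  · rw [← natCast_mod p (c * l ^ r * lget S r), h r hr, natCast_mod]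
  · rw [lget_eq_zero_of_le S r (by omega), mul_zero, Nat.cast_zero, lget_eq_zero_of_le A (q * r + B) ?_, Nat.cast_zero]
    have : q * R ≤ q * r := Nat.mul_le_mul_left q (by omega)
    omega

omit hp in
/-- The same with `c = l = 1`: `coeff r (ofList S) = coeff (q·r + B) (ofList A)` from a finite check. [folklore] -/
theorem coeff_ofList_eq_of_check {S A : List ℕ} {q B R : ℕ} (hA : A.length ≤ q * R + B) (hS : S.length ≤ R)
    (h : ∀ r < R, lget S r % p = lget A (q * r + B) % p) (r : ℕ) :
    coeff r (ofList S : K⟦X⟧) = coeff (q * r + B) (ofList A : K⟦X⟧) := by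
  have h1 := coeff_C_mul_rescale_ofList (K := K) p (c := 1) (l := 1) hA hS (fun r hr => by rw [one_pow, one_mul, one_mul, h r hr]) r
  rwa [Nat.cast_one, map_one, one_mul, rescale_one, RingHom.id_apply] at h1

end Eval

end ReducedRun

end CampaignW24

end Summit.ResolutionOfSingularities.ResolutionOfSingularities.Theorems

end
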